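import Literature.Probability.LatticeModels.SixVertexGFFWick
import Literature.Probability.LatticeModels.SixVertexGFFProofs
import Mathlib.MeasureTheory.Constructions.Pi
import Mathlib.MeasureTheory.Integral.Prod
import Mathlib.MeasureTheory.Integral.Pi

/-!
# The moments of the GFF pairing: Wick's formula under the integral (DKLM 2026, Part II §3)

H. Duminil-Copin, K. K. Kozlowski, P. Lammers, I. Manolescu, *Gaussian free field convergence of
the six-vertex model with `-1 ≤ Δ ≤ -1/2`*, arXiv:2603.06268 (2026) [DKLM2026SixVertexGFF]
(`paper:arxiv-2603.06268`, chunk p0034): "[…] to ensure the convergence to the corresponding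
moments of the GFF" — i.e. `∫ σ^k Ψ_k^GFF(u) dφ̃^k(u) = 𝔼[𝒩(0, σ² ℰ)^k]`.

For a weight `w` on `X = ℂ × ℂ` with `∫ w = 1` (the paper's `dφ̃(u, u') = dφ₋(u) dφ₊(u')`) and
`J_k := ∫_{X^k} Ψ_k^GFF(u) ∏ᵢ w(uᵢ) du`, Wick's formula (`gffKPoint_wick`) integrated coordinate-wise
gives the **Gaussian moment recursion** `J_{m+2} = (m+1) · E · J_m` with
`E = ∬ Ψ₂^GFF(x, y) w(x) w(y)`, whence `J_{2r} = (2r-1)‼ E^r` and `J_{2r+1} = 0` — the moments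
of `𝒩(0, E)`. The only analytic input is the integrability of `Ψ₂^GFF w ⊗ w` (hypothesis `hA`;
logarithmic singularities, `Literature/Analysis/SpecialFunctions/PlanarLogIntegrable.lean`).
[cite: DKLM2026SixVertexGFF, Part II §3, proof of Theorem 52]
-/

noncomputable section

open MeasureTheory Filter Topology Function Finset
open scoped Nat

namespace Literature.Probability.LatticeModels.SixVertex

/-- Pair space `X = ℂ × ℂ` (a point `u = (uᵢ, uᵢ')`). -/
local notation "X" => ℂ × ℂ

/-! ## 1. `Ψ₀^GFF = 1` and the integrals `J_k` -/

/-- `Ψ₀^GFF = 1` (the empty pairing). [cite: DKLM2026SixVertexGFF, Def. 2.6] -/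
theorem gffKPoint_zero (u : Fin 0 → X) : gffKPoint 0 u = 1 := by
  unfold gffKPoint fpfInvolutions
  simp [Finset.filter_true_of_mem]

/-- `J_k(w) = ∫_{X^k} Ψ_k^GFF(u) ∏ᵢ w(uᵢ) du`. [cite: DKLM2026SixVertexGFF, Part II §3] -/
def gffMomentIntegral (w : X → ℝ) (k : ℕ) : ℝ :=
  ∫ u : Fin k → X, gffKPoint k u * ∏ i, w (u i)

/-- `E(w) = ∬ Ψ₂^GFF(x,y) w(x) w(y) dx dy` (`= ℰ(φ₊ - φ₋)` for `w = φ₋ ⊗ φ₊`).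
[cite: DKLM2026SixVertexGFF, Part II §3] -/
def gffPairEnergy (w : X → ℝ) : ℝ :=
  ∫ p : X × X, gffKPoint 2 ![p.1, p.2] * (w p.1 * w p.2)

/-- `J_0 = 1`. [folklore] -/
theorem gffMomentIntegral_zero (w : X → ℝ) : gffMomentIntegral w 0 = 1 := by
  unfold gffMomentIntegral
  simp only [gffKPoint_zero, Finset.univ_eq_empty, Finset.prod_empty, mul_one]
  rw [integral_const, smul_eq_mul, mul_one, Measure.real, volume_pi, Measure.pi_univ]
  simp

/-- `J_{2r+1} = 0`. [cite: DKLM2026SixVertexGFF, Def. 2.6 (odd `k`)] -/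
theorem gffMomentIntegral_odd (w : X → ℝ) (r : ℕ) : gffMomentIntegral w (2 * r + 1) = 0 := by
  unfold gffMomentIntegral
  simp [gffKPoint_of_odd ⟨r, rfl⟩]

/-! ## 2. Splitting the coordinates `0` and `j = j'.succ` -/

/-- The measurable equivalence `u ↦ ((u₀, u_{j'+1}), (u_{(j'.succAbove i)+1})ᵢ)`. [folklore] -/
def splitPairEquiv (m : ℕ) (j' : Fin (m + 1)) : (Fin (m + 2) → X) ≃ᵐ (X × X) × (Fin m → X) :=
  ((MeasurableEquiv.piFinSuccAbove (fun _ : Fin (m + 2) => X) 0).trans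
    ((MeasurableEquiv.refl X).prodCongr (MeasurableEquiv.piFinSuccAbove (fun _ : Fin (m + 1) => X) j'))).trans
      MeasurableEquiv.prodAssoc.symm

/-- The splitting in coordinates. [folklore] -/
theorem splitPairEquiv_apply (m : ℕ) (j' : Fin (m + 1)) (u : Fin (m + 2) → X) :
    splitPairEquiv m j' u = ((u 0, u j'.succ), fun i => u (j'.succAbove i).succ) := by
  simp [splitPairEquiv, MeasurableEquiv.piFinSuccAbove, MeasurableEquiv.trans, MeasurableEquiv.prodCongr,
    MeasurableEquiv.prodAssoc]
  constructor <;> rfl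

/-- The splitting preserves Lebesgue measure. [folklore] -/
theorem measurePreserving_splitPairEquiv (m : ℕ) (j' : Fin (m + 1)) :
    MeasurePreserving (splitPairEquiv m j') volume volume := by
  have h0 := volume_preserving_piFinSuccAbove (fun _ : Fin (m + 2) => X) 0
  have h1 : MeasurePreserving ((MeasurableEquiv.refl X).prodCongr (MeasurableEquiv.piFinSuccAbove (fun _ : Fin (m + 1) => X) j'))
      (volume : Measure (X × (Fin (m + 1) → X))) (volume : Measure (X × (X × (Fin m → X)))) :=
    (MeasurePreserving.id volume).prod (volume_preserving_piFinSuccAbove (fun _ : Fin (m + 1) => X) j')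
  have h2 : MeasurePreserving (MeasurableEquiv.prodAssoc : (X × X) × (Fin m → X) ≃ᵐ X × (X × (Fin m → X)))
      volume volume :=
    ⟨MeasurableEquiv.prodAssoc.measurable, Measure.prodAssoc_prod⟩
  exact (h0.trans h1).trans (h2.symm _)

/-- `skipPairEmb m (j'+1) = succ ∘ j'.succAbove`. [folklore] -/
theorem skipPairEmb_succ_apply (m : ℕ) (j' : Fin (m + 1)) (i : Fin m) :
    skipPairEmb m j'.succ i = (j'.succAbove i).succ := by
  have hmono : StrictMono fun i : Fin m => (j'.succAbove i).succ :=
    (Fin.strictMono_succ).comp (Fin.strictMono_succAbove j')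
  have hmem : ∀ i : Fin m, (j'.succAbove i).succ ∈ ({0, partnerOf j'.succ} : Finset (Fin (m + 2)))ᶜ := by
    intro i
    rw [Finset.mem_compl, Finset.mem_insert, Finset.mem_singleton, partnerOf_of_ne (Fin.succ_ne_zero j')]
    push Not
    exact ⟨Fin.succ_ne_zero _, fun h => Fin.succAbove_ne j' i (Fin.succ_injective _ h)⟩
  have h := Finset.orderEmbOfFin_unique (card_compl_pair j'.succ) hmem hmono
  have := congrFun h i
  simpa [skipPairEmb] using this.symm

/-! ## 3. One Wick term under the integral -/

variable {w : X → ℝ}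

/-- The product weight splits: `∏_{i<m+2} w(uᵢ) = w(u₀) w(u_{j'+1}) ∏ᵢ w(u_{(j'.succAbove i)+1})`.
[folklore] -/
theorem prod_weight_split (w : X → ℝ) (m : ℕ) (j' : Fin (m + 1)) (u : Fin (m + 2) → X) :
    ∏ i, w (u i) = w (u 0) * w (u j'.succ) * ∏ i : Fin m, w (u (j'.succAbove i).succ) := by
  rw [Fin.prod_univ_succ, Fin.prod_univ_succAbove _ j']
  ring

/-- **One Wick term integrates to `E · J_m`** (and is integrable), given the integrability of
`Ψ₂ w⊗w` and of `Ψ_m w^{⊗m}`. [cite: DKLM2026SixVertexGFF, Part II §3, proof of Theorem 52] -/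
theorem integral_wickTerm (hA : Integrable (fun p : X × X => gffKPoint 2 ![p.1, p.2] * (w p.1 * w p.2)) (volume.prod volume))
    {m : ℕ} (hB : Integrable (fun s : Fin m → X => gffKPoint m s * ∏ i, w (s i)) volume) (j' : Fin (m + 1)) :
    Integrable (fun u : Fin (m + 2) → X =>
        gffKPoint 2 ![u 0, u j'.succ] * gffKPoint m (u ∘ skipPairEmb m j'.succ) * ∏ i, w (u i)) volume ∧
      ∫ u : Fin (m + 2) → X, gffKPoint 2 ![u 0, u j'.succ] * gffKPoint m (u ∘ skipPairEmb m j'.succ) * ∏ i, w (u i) =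
        gffPairEnergy w * gffMomentIntegral w m := by
  set Φ : (X × X) × (Fin m → X) → ℝ := fun q =>
    (gffKPoint 2 ![q.1.1, q.1.2] * (w q.1.1 * w q.1.2)) * (gffKPoint m q.2 * ∏ i, w (q.2 i)) with hΦ
  have hΦi : Integrable Φ ((volume.prod volume).prod volume) := hA.mul_prod hB
  have he := measurePreserving_splitPairEquiv m j'
  have hpt : ∀ u : Fin (m + 2) → X,
      gffKPoint 2 ![u 0, u j'.succ] * gffKPoint m (u ∘ skipPairEmb m j'.succ) * ∏ i, w (u i) = Φ (splitPairEquiv m j' u) := by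
    intro u
    have hskip : (u ∘ skipPairEmb m j'.succ) = fun i => u (j'.succAbove i).succ := by
      funext i
      simp [skipPairEmb_succ_apply]
    rw [splitPairEquiv_apply, hΦ, prod_weight_split w m j' u, hskip]
    simp only
    ring
  have hvol : (volume : Measure ((X × X) × (Fin m → X))) = (volume.prod volume).prod volume := rfl
  simp_rw [hpt]
  refine ⟨?_, ?_⟩
  · have h := (he.integrable_comp_emb (splitPairEquiv m j').measurableEmbedding (g := Φ)).2 (by rw [hvol]; exact hΦi)
    exact h
  · rw [he.integral_comp' Φ, hvol]
    exact integral_prod_mul (fun p : X × X => gffKPoint 2 ![p.1, p.2] * (w p.1 * w p.2))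
      (fun s : Fin m → X => gffKPoint m s * ∏ i, w (s i))

/-! ## 4. The recursion and the closed form -/

/-- **Integrability of `Ψ_m^GFF w^{⊗m}` and the Gaussian recursion `J_{m+2} = (m+1) E J_m`.**
[cite: DKLM2026SixVertexGFF, Part II §3, proof of Theorem 52] -/
theorem integrable_and_gffMomentIntegral_add_two
    (hA : Integrable (fun p : X × X => gffKPoint 2 ![p.1, p.2] * (w p.1 * w p.2)) (volume.prod volume)) (m : ℕ)
    (hB : Integrable (fun s : Fin m → X => gffKPoint m s * ∏ i, w (s i)) volume) :
    Integrable (fun u : Fin (m + 2) → X => gffKPoint (m + 2) u * ∏ i, w (u i)) volume ∧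
      gffMomentIntegral w (m + 2) = (m + 1) * gffPairEnergy w * gffMomentIntegral w m := by
  -- Wick: the integrand is the sum over `j' : Fin (m+1)` of the Wick terms
  have hwick : ∀ u : Fin (m + 2) → X, gffKPoint (m + 2) u * ∏ i, w (u i) =
      ∑ j' : Fin (m + 1), gffKPoint 2 ![u 0, u j'.succ] * gffKPoint m (u ∘ skipPairEmb m j'.succ) * ∏ i, w (u i) := by
    intro u
    rw [gffKPoint_wick, Finset.sum_mul]
    have hsum := Fin.sum_univ_succ fun j : Fin (m + 2) =>
      gffKPoint 2 ![u 0, u j] * gffKPoint m (u ∘ skipPairEmb m j) * ∏ i, w (u i)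
    have hsplit := Finset.add_sum_erase Finset.univ
      (fun j : Fin (m + 2) => gffKPoint 2 ![u 0, u j] * gffKPoint m (u ∘ skipPairEmb m j) * ∏ i, w (u i))
      (Finset.mem_univ (0 : Fin (m + 2)))
    linarith
  have hterm := fun j' : Fin (m + 1) => integral_wickTerm hA hB j'
  have hfun : (fun u : Fin (m + 2) → X => gffKPoint (m + 2) u * ∏ i, w (u i)) = fun u =>
      ∑ j' : Fin (m + 1), gffKPoint 2 ![u 0, u j'.succ] * gffKPoint m (u ∘ skipPairEmb m j'.succ) * ∏ i, w (u i) :=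
    funext hwick
  refine ⟨?_, ?_⟩
  · rw [hfun]
    exact integrable_finsetSum _ fun j' _ => (hterm j').1
  · have h1 : gffMomentIntegral w (m + 2) =
        ∫ u : Fin (m + 2) → X, ∑ j' : Fin (m + 1),
          gffKPoint 2 ![u 0, u j'.succ] * gffKPoint m (u ∘ skipPairEmb m j'.succ) * ∏ i, w (u i) := by
      unfold gffMomentIntegral
      rw [hfun]
    rw [h1, integral_finsetSum _ fun j' _ => (hterm j').1, Finset.sum_congr rfl fun j' _ => (hterm j').2,
      Finset.sum_const, Finset.card_univ, Fintype.card_fin, nsmul_eq_mul]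
    push_cast
    ring

/-- **The moments of the GFF pairing are Gaussian**: `J_{2r} = (2r-1)‼ E^r` (and `J_{2r+1} = 0`,
`gffMomentIntegral_odd`), with `Ψ_k^GFF w^{⊗k}` integrable for every `k`.
[cite: DKLM2026SixVertexGFF, Part II §3, proof of Theorem 52] -/
theorem integrable_gffKPoint_mul_prod
    (hA : Integrable (fun p : X × X => gffKPoint 2 ![p.1, p.2] * (w p.1 * w p.2)) (volume.prod volume)) :
    ∀ k : ℕ, Integrable (fun u : Fin k → X => gffKPoint k u * ∏ i, w (u i)) volume := by
  intro k
  induction k using Nat.twoStepInduction with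
  | zero =>
    simp only [gffKPoint_zero, Finset.univ_eq_empty, Finset.prod_empty, mul_one]
    haveI : IsFiniteMeasure (volume : Measure (Fin 0 → X)) := by
      rw [volume_pi]
      infer_instance
    exact integrable_const _
  | one =>
    have : (fun u : Fin 1 → X => gffKPoint 1 u * ∏ i, w (u i)) = fun _ => 0 := by
      funext u
      rw [gffKPoint_of_odd (k := 1) ⟨0, rfl⟩, zero_mul]
    rw [this]
    exact integrable_zero _ _ _
  | more m hm _ => exact (integrable_and_gffMomentIntegral_add_two hA m hm).1

/-- **`J_{2r} = (2r-1)‼ E^r`.** [cite: DKLM2026SixVertexGFF, Part II §3, proof of Theorem 52] -/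
theorem gffMomentIntegral_even
    (hA : Integrable (fun p : X × X => gffKPoint 2 ![p.1, p.2] * (w p.1 * w p.2)) (volume.prod volume)) (r : ℕ) :
    gffMomentIntegral w (2 * r) = ((2 * r - 1)‼ : ℝ) * gffPairEnergy w ^ r := by
  induction r with
  | zero => simp [gffMomentIntegral_zero]
  | succ r ih =>
    have h := (integrable_and_gffMomentIntegral_add_two hA (2 * r) (integrable_gffKPoint_mul_prod hA (2 * r))).2
    rw [show 2 * (r + 1) = 2 * r + 2 by ring, h, ih, show 2 * r + 2 - 1 = 2 * r + 1 by omega,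
      Nat.doubleFactorial_add_one (2 * r)]
    push_cast
    ring

end Literature.Probability.LatticeModels.SixVertex

end
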